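import Summits.ABC.ABC.Theorems.TwistAmplificationSharpModerateLawDefs
import Literature.NumberTheory.DiophantineGeometry.AbcWave0

/-!
# Crux `TwistAmplification.SharpModerateLaw` (stmt-ABC-1975), line `syzygy-lattice-half-deep-few-primes`:
Frey pairs of abc triples in cusp coordinates

Support file 1/2 of the calibration `CuspShellLawCone → MazurKaneLaw` (file
`TwistAmplificationSharpModerateLawMazurKaneCalibration.lean`).  The untwisted Frey curve
`y² = x(x−a)(x+b)` of a pair `(a, b)` of coprime positive integers has cusp coordinates

  `freyPair a b = (c₄, c₆) = (16(a²+ab+b²), −32(b−a)(2a+b)(a+2b))`, `c₄³ − c₆² = 1728·16(ab(a+b))²`.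

Proved here, over the line's cusp vocabulary (`TF`, `N5cusp`, `Mcusp` of `…SharpModerateLawDefs`):
* coprimality: no prime divides both `A = a²+ab+b²` and `ab(a+b)`; only `3` can divide both `A` and
  `(b−a)(2a+b)(a+2b)`; `2 ∤ A`, `9 ∤ A` (`not_dvd_freyA_of_dvd_abc`, `not_dvd_freyA_of_dvd_P`, …);
* `tf_freyPair` — the pair is tower-free;
* `n5cusp_freyPair_le_rad` — the conductor proxy is at most `rad(ab(a+b))` (every `p ≥ 5` of `Δ` is
  multiplicative: `p ∤ c₄`);
* `mcusp_freyPair` — the level is `(16A)³` exactly (the syzygy `4A³ = P² + 27(ab(a+b))²`), and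
  `mcusp_freyPair_bounds` — `27N⁶ < Mcusp < 4096N⁶` for `a + b ∈ (N/2, N]`;
* `freyPair_inj` — `(a, b) ↦ freyPair a b` is injective on pairs of positive integers
  (`c³ − A·c = abc` is increasing in `c`, then `ab` and `b − a` are recovered).
-/

noncomputable section

namespace Summit.ABC.ABC.Theorems.SharpModerateLaw

open Literature.NumberTheory.DiophantineGeometry (IsABCTriple rad)
open Finset

/-! ## 1. The Frey pair of `(a, b)` -/

/-- `A(a,b) = a² + ab + b²` (`c₄ = 16·A` for the Frey curve `y² = x(x−a)(x+b)`). -/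
def freyA (a b : ℕ) : ℤ := (a : ℤ) ^ 2 + a * b + (b : ℤ) ^ 2

/-- The cusp pair `(c₄, c₆) = (16(a²+ab+b²), −32(b−a)(2a+b)(a+2b))` of the untwisted Frey curve
`y² = x(x−a)(x+b)` of the pair `(a, b)`. -/
def freyPair (a b : ℕ) : ℤ × ℤ :=
  (16 * freyA a b, -32 * ((b : ℤ) - a) * (2 * a + b) * (a + 2 * b))

/-- First coordinate of the Frey pair. -/
theorem freyPair_fst (a b : ℕ) : (freyPair a b).1 = 16 * freyA a b := rfl

/-- Second coordinate of the Frey pair. -/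
theorem freyPair_snd (a b : ℕ) :
    (freyPair a b).2 = -32 * ((b : ℤ) - a) * (2 * a + b) * (a + 2 * b) := rfl

/-- The syzygy `c₄³ − c₆² = 1728·Δ`, `Δ = 16(ab(a+b))²`, of the Frey pair. -/
theorem freyPair_cube_sub_sq (a b : ℕ) :
    (freyPair a b).1 ^ 3 - (freyPair a b).2 ^ 2 = 1728 * (16 * ((a : ℤ) * b * (a + b)) ^ 2) := by
  simp only [freyPair, freyA]; ring

/-- `Δ = (c₄³ − c₆²)/1728 = 16(ab(a+b))²` exactly. -/
theorem freyPair_delta (a b : ℕ) :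
    ((freyPair a b).1 ^ 3 - (freyPair a b).2 ^ 2) / 1728 = 16 * ((a : ℤ) * b * (a + b)) ^ 2 := by
  rw [freyPair_cube_sub_sq]; simp

/-! ## 2. Coprimality: which primes can divide `A` -/

/-- No prime divides both `A = a² + ab + b²` and `ab(a+b)` when `gcd(a, b) = 1`. -/
theorem not_dvd_freyA_of_dvd_abc {a b : ℕ} (hab : Nat.Coprime a b) {p : ℕ} (hp : p.Prime)
    (hA : (p : ℤ) ∣ freyA a b) (habc : (p : ℤ) ∣ (a : ℤ) * b * (a + b)) : False := by
  have hp' : Prime (p : ℤ) := Nat.prime_iff_prime_int.mp hp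
  have key : (p : ℤ) ∣ (a : ℤ) ∧ (p : ℤ) ∣ (b : ℤ) := by
    rcases hp'.dvd_or_dvd habc with h | h
    · rcases hp'.dvd_or_dvd h with ha | hb
      · have h2 : (p : ℤ) ∣ (b : ℤ) ^ 2 := by
          have e : (b : ℤ) ^ 2 = freyA a b - a * (a + b) := by simp only [freyA]; ring
          rw [e]; exact dvd_sub hA (dvd_mul_of_dvd_left ha _)
        exact ⟨ha, hp'.dvd_of_dvd_pow h2⟩
      · have h2 : (p : ℤ) ∣ (a : ℤ) ^ 2 := by
          have e : (a : ℤ) ^ 2 = freyA a b - b * (a + b) := by simp only [freyA]; ring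
          rw [e]; exact dvd_sub hA (dvd_mul_of_dvd_left hb _)
        exact ⟨hp'.dvd_of_dvd_pow h2, hb⟩
    · have h2 : (p : ℤ) ∣ (a : ℤ) * b := by
        have e : (a : ℤ) * b = (a + b) ^ 2 - freyA a b := by simp only [freyA]; ring
        rw [e]; exact dvd_sub (dvd_pow h two_ne_zero) hA
      rcases hp'.dvd_or_dvd h2 with ha | hb
      · exact ⟨ha, by simpa using dvd_sub h ha⟩
      · exact ⟨by simpa using dvd_sub h hb, hb⟩
  obtain ⟨ha, hb⟩ := key
  have ha' : p ∣ a := Int.natCast_dvd_natCast.mp ha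
  have hb' : p ∣ b := Int.natCast_dvd_natCast.mp hb
  have h1 : p ∣ Nat.gcd a b := Nat.dvd_gcd ha' hb'
  rw [hab.gcd_eq_one] at h1
  exact hp.ne_one (Nat.dvd_one.mp h1)

/-- Only the prime `3` can divide both `A = a² + ab + b²` and `(b−a)(2a+b)(a+2b)` when `gcd(a,b) = 1`
(`A = (b−a)² + 3ab = (2a+b)² − 3a(a+b) = (a+2b)² − 3b(a+b)`). -/
theorem not_dvd_freyA_of_dvd_P {a b : ℕ} (hab : Nat.Coprime a b) {p : ℕ} (hp : p.Prime) (hp3 : p ≠ 3)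
    (hA : (p : ℤ) ∣ freyA a b) (hP : (p : ℤ) ∣ ((b : ℤ) - a) * (2 * a + b) * (a + 2 * b)) : False := by
  have hp' : Prime (p : ℤ) := Nat.prime_iff_prime_int.mp hp
  have h3 : ¬ (p : ℤ) ∣ 3 := by
    intro h
    have h' : p ∣ 3 := Int.natCast_dvd_natCast.mp h
    rcases (Nat.dvd_prime Nat.prime_three).mp h' with h1 | h1
    · exact hp.ne_one h1
    · exact hp3 h1
  apply not_dvd_freyA_of_dvd_abc hab hp hA
  rcases hp'.dvd_or_dvd hP with h | h
  · rcases hp'.dvd_or_dvd h with h | h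
    · have h2 : (p : ℤ) ∣ 3 * ((a : ℤ) * b) := by
        have e : 3 * ((a : ℤ) * b) = freyA a b - (b - a) ^ 2 := by simp only [freyA]; ring
        rw [e]; exact dvd_sub hA (dvd_pow h two_ne_zero)
      rcases hp'.dvd_or_dvd h2 with h' | h'
      · exact absurd h' h3
      · exact dvd_mul_of_dvd_left h' _
    · have h2 : (p : ℤ) ∣ 3 * ((a : ℤ) * (a + b)) := by
        have e : 3 * ((a : ℤ) * (a + b)) = (2 * a + b) ^ 2 - freyA a b := by simp only [freyA]; ring
        rw [e]; exact dvd_sub (dvd_pow h two_ne_zero) hA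
      rcases hp'.dvd_or_dvd h2 with h' | h'
      · exact absurd h' h3
      · rcases hp'.dvd_or_dvd h' with h'' | h''
        · exact dvd_mul_of_dvd_left (dvd_mul_of_dvd_left h'' _) _
        · exact dvd_mul_of_dvd_right h'' _
  · have h2 : (p : ℤ) ∣ 3 * ((b : ℤ) * (a + b)) := by
      have e : 3 * ((b : ℤ) * (a + b)) = (a + 2 * b) ^ 2 - freyA a b := by simp only [freyA]; ring
      rw [e]; exact dvd_sub (dvd_pow h two_ne_zero) hA
    rcases hp'.dvd_or_dvd h2 with h' | h'
    · exact absurd h' h3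
    · rcases hp'.dvd_or_dvd h' with h'' | h''
      · exact dvd_mul_of_dvd_left (dvd_mul_of_dvd_right h'' _) _
      · exact dvd_mul_of_dvd_right h'' _

/-- `A = a² + ab + b²` is odd when `gcd(a,b) = 1` (one of `a, b, a+b` is even). -/
theorem two_not_dvd_freyA {a b : ℕ} (hab : Nat.Coprime a b) : ¬ (2 : ℤ) ∣ freyA a b := by
  intro h
  refine not_dvd_freyA_of_dvd_abc hab Nat.prime_two (by exact_mod_cast h) ?_
  show ((2 : ℕ) : ℤ) ∣ (a : ℤ) * b * (a + b)
  rcases Int.even_or_odd (a : ℤ) with ha | ha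
  · exact dvd_mul_of_dvd_left (dvd_mul_of_dvd_left (even_iff_two_dvd.mp ha) _) _
  · rcases Int.even_or_odd (b : ℤ) with hb | hb
    · exact dvd_mul_of_dvd_left (dvd_mul_of_dvd_right (even_iff_two_dvd.mp hb) _) _
    · exact dvd_mul_of_dvd_right (even_iff_two_dvd.mp (ha.add_odd hb)) _

/-- `9 ∤ A = a² + ab + b²` when `gcd(a,b) = 1` (`A = (b−a)² + 3ab`: `3 ∣ A` forces `3 ∣ b − a`, then
`9 ∣ A` would force `3 ∣ ab`). -/
theorem nine_not_dvd_freyA {a b : ℕ} (hab : Nat.Coprime a b) : ¬ (9 : ℤ) ∣ freyA a b := by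
  intro h9
  have h3p : Prime (3 : ℤ) := Int.prime_three
  have e : freyA a b = ((b : ℤ) - a) ^ 2 + 3 * (a * b) := by simp only [freyA]; ring
  have h3A : (3 : ℤ) ∣ freyA a b := dvd_trans ⟨3, by norm_num⟩ h9
  have hba : (3 : ℤ) ∣ (b : ℤ) - a := by
    have h1 : (3 : ℤ) ∣ ((b : ℤ) - a) ^ 2 := by
      have e' : ((b : ℤ) - a) ^ 2 = freyA a b - 3 * (a * b) := by rw [e]; ring
      rw [e']; exact dvd_sub h3A (dvd_mul_right 3 _)
    exact h3p.dvd_of_dvd_pow h1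
  have h9sq : (9 : ℤ) ∣ ((b : ℤ) - a) ^ 2 := by
    obtain ⟨k, hk⟩ := hba; exact ⟨k ^ 2, by rw [hk]; ring⟩
  have h9ab : (9 : ℤ) ∣ 3 * ((a : ℤ) * b) := by
    have e' : 3 * ((a : ℤ) * b) = freyA a b - ((b : ℤ) - a) ^ 2 := by rw [e]; ring
    rw [e']; exact dvd_sub h9 h9sq
  have h3ab : (3 : ℤ) ∣ (a : ℤ) * b := by
    obtain ⟨k, hk⟩ := h9ab
    exact ⟨k, by linarith⟩
  refine not_dvd_freyA_of_dvd_abc hab Nat.prime_three (by exact_mod_cast h3A) ?_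
  show ((3 : ℕ) : ℤ) ∣ (a : ℤ) * b * (a + b)
  exact dvd_mul_of_dvd_left h3ab _

/-- A prime `p ≥ 5` does not divide `2^k`. -/
private theorem not_dvd_two_pow_of_five_le {p : ℕ} (hp : p.Prime) (h5 : 5 ≤ p) (k : ℕ) :
    ¬ (p : ℤ) ∣ (2 : ℤ) ^ k := by
  intro h
  have h' : p ∣ 2 ^ k := by exact_mod_cast h
  have := (Nat.prime_dvd_prime_iff_eq hp Nat.prime_two).mp (hp.dvd_of_dvd_pow h')
  omega

/-- **Tower-freeness of the Frey pair** (`gcd(a,b) = 1`). -/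
theorem tf_freyPair {a b : ℕ} (hab : Nat.Coprime a b) : TF (freyPair a b) := by
  refine ⟨fun p hp h5 h46 => ?_, fun h => ?_, fun h => ?_⟩
  · obtain ⟨h4, h6⟩ := h46
    have hp' : Prime (p : ℤ) := Nat.prime_iff_prime_int.mp hp
    have hpA : (p : ℤ) ∣ freyA a b := by
      have h1 : (p : ℤ) ∣ 16 * freyA a b := (dvd_pow_self (p : ℤ) four_ne_zero).trans h4
      rcases hp'.dvd_or_dvd h1 with h | h
      · exact absurd (by simpa using h) (not_dvd_two_pow_of_five_le hp h5 4)
      · exact h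
    have hpP : (p : ℤ) ∣ ((b : ℤ) - a) * (2 * a + b) * (a + 2 * b) := by
      have h1 : (p : ℤ) ∣ (freyPair a b).2 := (dvd_pow_self (p : ℤ) (by norm_num)).trans h6
      have e : (freyPair a b).2 = (-(2 : ℤ) ^ 5) * (((b : ℤ) - a) * (2 * a + b) * (a + 2 * b)) := by
        rw [freyPair_snd]; ring
      rw [e] at h1
      rcases hp'.dvd_or_dvd h1 with h | h
      · exact absurd ((dvd_neg).mp h) (not_dvd_two_pow_of_five_le hp h5 5)
      · exact h
    exact not_dvd_freyA_of_dvd_P hab hp (by omega) hpA hpP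
  · obtain ⟨h8, -⟩ := h
    apply two_not_dvd_freyA hab
    rw [freyPair_fst] at h8
    obtain ⟨k, hk⟩ := h8
    exact ⟨8 * k, by linarith⟩
  · obtain ⟨h5, -⟩ := h
    apply nine_not_dvd_freyA hab
    rw [freyPair_fst] at h5
    have h9 : (9 : ℤ) ∣ 16 * freyA a b := dvd_trans ⟨27, by norm_num⟩ h5
    exact (Int.isCoprime_iff_gcd_eq_one.mpr (by norm_num) : IsCoprime (9 : ℤ) 16).dvd_of_dvd_mul_left h9

/-! ## 3. The invariants `N5cusp`, `Mcusp` of the Frey pair -/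

/-- `Δ.natAbs = 16(ab(a+b))²` as a natural number. -/
theorem natAbs_freyPair_delta (a b : ℕ) :
    (((freyPair a b).1 ^ 3 - (freyPair a b).2 ^ 2) / 1728).natAbs = 16 * (a * b * (a + b)) ^ 2 := by
  rw [freyPair_delta]
  have e : (16 * ((a : ℤ) * b * (a + b)) ^ 2) = ((16 * (a * b * (a + b)) ^ 2 : ℕ) : ℤ) := by push_cast; ring
  rw [e, Int.natAbs_natCast]

/-- `|c₄| = 16(a²+ab+b²)` as a natural number. -/
theorem natAbs_freyPair_fst (a b : ℕ) : ((freyPair a b).1).natAbs = 16 * (a ^ 2 + a * b + b ^ 2) := by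
  rw [freyPair_fst]
  have e : 16 * freyA a b = ((16 * (a ^ 2 + a * b + b ^ 2) : ℕ) : ℤ) := by simp only [freyA]; push_cast; ring
  rw [e, Int.natAbs_natCast]

/-- **The conductor proxy of the Frey pair is at most the radical**: every prime `p ≥ 5` of
`Δ = 16(abc)²` divides `abc` and does not divide `c₄ = 16A`, so it is charged `p¹`. -/
theorem n5cusp_freyPair_le_rad {a b : ℕ} (ha : 0 < a) (hb : 0 < b) (hab : Nat.Coprime a b) :
    N5cusp (freyPair a b) ≤ rad a b (a + b) := by
  unfold N5cusp
  rw [natAbs_freyPair_delta]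
  set m : ℕ := a * b * (a + b) with hm
  have hm0 : m ≠ 0 := by positivity
  have hsub : (16 * m ^ 2).primeFactors.filter (fun p => 5 ≤ p) ⊆ m.primeFactors := by
    intro p hp
    obtain ⟨hpF, h5⟩ := Finset.mem_filter.mp hp
    have hpp : p.Prime := Nat.prime_of_mem_primeFactors hpF
    have hdvd : p ∣ 16 * m ^ 2 := Nat.dvd_of_mem_primeFactors hpF
    have hpm : p ∣ m := by
      rcases (Nat.Prime.dvd_mul hpp).mp hdvd with h | h
      · exfalso
        have := (Nat.prime_dvd_prime_iff_eq hpp Nat.prime_two).mp (hpp.dvd_of_dvd_pow (show p ∣ 2 ^ 4 from h))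
        omega
      · exact hpp.dvd_of_dvd_pow h
    exact Nat.mem_primeFactors.mpr ⟨hpp, hpm, hm0⟩
  have hcongr : ∀ p ∈ (16 * m ^ 2).primeFactors.filter (fun p => 5 ≤ p),
      (if ((p : ℕ) : ℤ) ∣ (freyPair a b).1 then p ^ 2 else p) = p := by
    intro p hp
    obtain ⟨hpF, h5⟩ := Finset.mem_filter.mp hp
    have hpp : p.Prime := Nat.prime_of_mem_primeFactors hpF
    have hpm : p ∣ m := Nat.dvd_of_mem_primeFactors (hsub hp)
    rw [if_neg]
    intro hdiv
    rw [freyPair_fst] at hdiv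
    have hp' : Prime (p : ℤ) := Nat.prime_iff_prime_int.mp hpp
    have hpA : (p : ℤ) ∣ freyA a b := by
      rcases hp'.dvd_or_dvd hdiv with h | h
      · exact absurd (by simpa using h) (not_dvd_two_pow_of_five_le hpp h5 4)
      · exact h
    refine not_dvd_freyA_of_dvd_abc hab hpp hpA ?_
    rw [hm] at hpm
    exact_mod_cast hpm
  rw [Finset.prod_congr rfl hcongr]
  calc ∏ p ∈ (16 * m ^ 2).primeFactors.filter (fun p => 5 ≤ p), p
      ≤ ∏ p ∈ m.primeFactors, p :=
        Finset.prod_le_prod_of_subset_of_one_le' hsub fun p hp _ => (Nat.prime_of_mem_primeFactors hp).one_lt.le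
    _ = rad a b (a + b) := by
        rw [Literature.NumberTheory.DiophantineGeometry.rad_def, Nat.radical_eq_prod_primeFactors]

/-- **The level of the Frey pair**: `Mcusp = (16(a²+ab+b²))³` (the `|c₄|³`-branch wins, by the
syzygy `4A³ = P² + 27(ab(a+b))²`). -/
theorem mcusp_freyPair (a b : ℕ) : Mcusp (freyPair a b) = (16 * (a ^ 2 + a * b + b ^ 2)) ^ 3 := by
  unfold Mcusp
  rw [natAbs_freyPair_delta, natAbs_freyPair_fst]
  apply max_eq_right
  have key : (16 * (a * b * (a + b)) ^ 2 : ℤ) ≤ (16 * (a ^ 2 + a * b + b ^ 2)) ^ 3 := by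
    have e : 4 * ((a : ℤ) ^ 2 + a * b + b ^ 2) ^ 3 =
        (((b : ℤ) - a) * (2 * a + b) * (a + 2 * b)) ^ 2 + 27 * (a * b * (a + b)) ^ 2 := by ring
    nlinarith [sq_nonneg (((b : ℤ) - a) * (2 * a + b) * (a + 2 * b)), sq_nonneg ((a : ℤ) * b * (a + b))]
  exact_mod_cast key

/-- Level bounds for `c = a + b ∈ (N/2, N]`: `27N⁶ < Mcusp ≤ 4096N⁶ − 1` (as reals:
`27N⁶ < Mcusp` and `Mcusp < 4096N⁶`), from `3c² ≤ 4A` and `A < c²`. -/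
theorem mcusp_freyPair_bounds {a b N : ℕ} (ha : 0 < a) (hb : 0 < b) (hcN : a + b ≤ N) (hNc : N < 2 * (a + b)) :
    27 * (N : ℝ) ^ 6 < (Mcusp (freyPair a b) : ℝ) ∧ (Mcusp (freyPair a b) : ℝ) < 4096 * (N : ℝ) ^ 6 := by
  rw [mcusp_freyPair]
  push_cast
  set A : ℝ := (a : ℝ) ^ 2 + a * b + (b : ℝ) ^ 2 with hA
  set c : ℝ := (a : ℝ) + b with hc
  have ha' : (1 : ℝ) ≤ a := by exact_mod_cast ha
  have hb' : (1 : ℝ) ≤ b := by exact_mod_cast hb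
  have hcN' : c ≤ N := by rw [hc]; exact_mod_cast hcN
  have hNc' : (N : ℝ) < 2 * c := by rw [hc]; exact_mod_cast hNc
  have hN0 : (0 : ℝ) ≤ N := Nat.cast_nonneg N
  have hlow : 3 * c ^ 2 ≤ 4 * A := by rw [hA, hc]; nlinarith [sq_nonneg ((a : ℝ) - b)]
  have hup : A < c ^ 2 := by rw [hA, hc]; nlinarith
  have hc0 : 0 < c := by rw [hc]; linarith
  have hA0 : 0 < A := by rw [hA]; positivity
  constructor
  · -- 27 N⁶ < (3/4·(2c)²)³·... : N < 2c ⇒ N⁶ < 64 c⁶ ⇒ 27N⁶ < 1728 c⁶ ≤ (16A)³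
    have h1 : (N : ℝ) ^ 2 < (2 * c) ^ 2 := by nlinarith
    have h2 : (N : ℝ) ^ 6 < (2 * c) ^ 6 := by
      have := pow_lt_pow_left₀ hNc' hN0 (by norm_num : (6 : ℕ) ≠ 0)
      simpa using this
    have h3 : (12 * c ^ 2) ^ 3 ≤ (16 * A) ^ 3 :=
      pow_le_pow_left₀ (by positivity) (by linarith) 3
    nlinarith [h2, h3]
  · have h1 : (16 * A) ^ 3 < (16 * c ^ 2) ^ 3 :=
      pow_lt_pow_left₀ (by linarith) (by positivity) (by norm_num)
    have h2 : c ^ 6 ≤ (N : ℝ) ^ 6 := pow_le_pow_left₀ hc0.le hcN' 6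
    nlinarith [h1, h2]

/-! ## 4. Injectivity of the Frey pair on triples -/

/-- The Frey pair determines the (ordered) pair `(a, b)` of positive integers: `A` and `abc` are
determined (`16A = c₄`, `27648(abc)² = c₄³ − c₆²`), `c ↦ c³ − A·c = abc` is injective on `c² > A`,
then `ab` and finally `b − a` (from `c₆ = −32(b−a)(2c² + ab)`). -/
theorem freyPair_inj {a b a' b' : ℕ} (ha : 0 < a) (hb : 0 < b) (ha' : 0 < a') (hb' : 0 < b')
    (h : freyPair a b = freyPair a' b') : a = a' ∧ b = b' := by
  have h1 : freyA a b = freyA a' b' := by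
    have := congrArg Prod.fst h
    rw [freyPair_fst, freyPair_fst] at this
    linarith
  have h2 : ((b : ℤ) - a) * (2 * a + b) * (a + 2 * b) = ((b' : ℤ) - a') * (2 * a' + b') * (a' + 2 * b') := by
    have := congrArg Prod.snd h
    rw [freyPair_snd, freyPair_snd] at this
    linarith
  have h3 : ((a : ℤ) * b * (a + b)) ^ 2 = ((a' : ℤ) * b' * (a' + b')) ^ 2 := by
    have e := freyPair_cube_sub_sq a b
    have e' := freyPair_cube_sub_sq a' b'
    rw [h] at e
    linarith
  have haR : (0 : ℤ) < a := by exact_mod_cast ha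
  have hbR : (0 : ℤ) < b := by exact_mod_cast hb
  have haR' : (0 : ℤ) < a' := by exact_mod_cast ha'
  have hbR' : (0 : ℤ) < b' := by exact_mod_cast hb'
  have h4 : (a : ℤ) * b * (a + b) = (a' : ℤ) * b' * (a' + b') := by
    have hx : (0 : ℤ) ≤ (a : ℤ) * b * (a + b) := by positivity
    have hy : (0 : ℤ) ≤ (a' : ℤ) * b' * (a' + b') := by positivity
    exact (pow_left_inj₀ hx hy two_ne_zero).mp h3
  simp only [freyA] at h1
  -- `c = c'`
  have hc : (a : ℤ) + b = a' + b' := by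
    rcases lt_trichotomy ((a : ℤ) + b) (a' + b') with hlt | heq | hgt
    · exfalso
      -- p' - p = c'² - c² > 0 and p c = p' c' : impossible
      have hp : (a' : ℤ) * b' - a * b = (a' + b') ^ 2 - (a + b) ^ 2 := by linarith
      have hpos : (0 : ℤ) < (a' + b') ^ 2 - ((a : ℤ) + b) ^ 2 := by nlinarith
      nlinarith [mul_pos (mul_pos haR hbR) (sub_pos.mpr hlt), mul_pos hpos (by linarith : (0 : ℤ) < a' + b')]
    · exact heq
    · exfalso
      have hp : (a : ℤ) * b - a' * b' = (a + b) ^ 2 - (a' + b') ^ 2 := by linarith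
      have hpos : (0 : ℤ) < ((a : ℤ) + b) ^ 2 - ((a' : ℤ) + b') ^ 2 := by nlinarith
      nlinarith [mul_pos (mul_pos haR' hbR') (sub_pos.mpr hgt), mul_pos hpos (by linarith : (0 : ℤ) < a + b)]
  -- `ab = a'b'`
  have hprod : (a : ℤ) * b = a' * b' := by
    have hc0 : (0 : ℤ) < a + b := by linarith
    have : (a : ℤ) * b * (a + b) = a' * b' * (a + b) := by rw [h4, hc]
    exact mul_right_cancel₀ hc0.ne' this
  -- `b - a = b' - a'`
  have hdiff : (b : ℤ) - a = b' - a' := by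
    have e1 : ((b : ℤ) - a) * (2 * a + b) * (a + 2 * b) = ((b : ℤ) - a) * (2 * (a + b) ^ 2 + a * b) := by ring
    have e2 : ((b' : ℤ) - a') * (2 * a' + b') * (a' + 2 * b') = ((b' : ℤ) - a') * (2 * (a' + b') ^ 2 + a' * b') := by
      ring
    rw [e1, e2, ← hc, ← hprod] at h2
    have hQ : (0 : ℤ) < 2 * ((a : ℤ) + b) ^ 2 + a * b := by positivity
    exact mul_right_cancel₀ hQ.ne' h2
  constructor
  · have : (a : ℤ) = a' := by linarith
    exact_mod_cast this
  · have : (b : ℤ) = b' := by linarith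
    exact_mod_cast this



/-- Registered sub-goal `freyPairs_main` of stmt-ABC-1975 (support 1/2 of the calibration
`CuspShellLawCone → MazurKaneLaw`): the Frey pair of a coprime pair is tower-free and its conductor proxy
is at most the radical. -/
theorem freyPairs_main : ∀ a b : ℕ, 0 < a → 0 < b → Nat.Coprime a b → TF (freyPair a b) ∧ N5cusp (freyPair a b) ≤ Literature.NumberTheory.DiophantineGeometry.rad a b (a + b) :=
  fun _ _ ha hb hab => ⟨tf_freyPair hab, n5cusp_freyPair_le_rad ha hb hab⟩

end Summit.ABC.ABC.Theorems.SharpModerateLaw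

end
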